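import Summits.BirchSwinnertonDyer.BirchSwinnertonDyer.Theorems.UniversalToricDescentLambdaTransport
import Summits.BirchSwinnertonDyer.BirchSwinnertonDyer.Theorems.UniversalToricDescentSigmaPassage
import Mathlib.Algebra.Module.CharacterModule
import HarnessLib

/-!
# Route UniversalToricDescent — the `Σ`-FREE λ-transport count: with (N1) only at `Σ = ∅`,
# `p^{λ(X_ac^∅(E₁))} · #(Sel^Σ(E₁)/Sel^∅(E₁))[p] = p^{λ(X_ac^∅(E₂))} · #(Sel^Σ(E₂)/Sel^∅(E₂))[p]`

Lead prover bsd-wall-utd-p1 g7 (`--supports stmt-BirchSwinnertonDyer-20399`; PRICING-20399-ALG-HALF §3(c),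
g6's open list «(N1) ×2 at `Σ`-level; `Σ → ∅` λ-terms»). Greenberg–Vatsal's exact λ-transport (g6,
`UniversalToricDescentLambdaTransport`) needs «no non-zero finite `Λ`-submodule» (N1) for the
`Σ`-IMPRIMITIVE duals `X_ac^Σ(E_i)` of BOTH curves; the tree proves (N1) (modulo cited facts) only at
`Σ = ∅` (`UniversalToricDescentNoFiniteSubmoduleOfCoinvariants`, from (L10) `CoinvariantsTrivialAt`). This
file removes the `Σ`-level (N1) from the algebraic half of 21845 by counting one step earlier:

* §1 (pure group theory) `natCard_nsmulTorsion_eq_mul_of_divisible` — for an abelian group `A`, a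
  subgroup `H ≤ A` that is `n`-divisible inside itself, `#A[n] = #H[n] · #(A/H)[n]` (`Nat.card`; the
  sequence `0 → H[n] → A[n] → (A/H)[n] → 0` is exact because `H = nH`).
* §2 (one curve, any `K`, any `ℤ_p`-extension, finite `Σ`) for `X = X_ac^Σ(E[p^∞])` (`AcSelmer.XAc`):
  `XAc.eq_zero_of_nsmul_eq_zero` — `X^∅` torsion, `μ = 0`, (N1) ⟹ `X^∅` has no `p`-torsion (tree
  `Iwasawa.noZeroSMulDivisors_of_forall_finite_eq_bot`); `selmerAc_divisible_of_forall` — then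
  `Sel_𝔭^Σ(K_∞, E[p^∞])` is `p`-DIVISIBLE (a class outside `p·Sel` is seen by a character of `Sel/p·Sel`,
  Mathlib `CharacterModule.exists_character_apply_ne_zero_of_ne_zero`, giving a non-zero `p`-torsion
  element of `X`); `pow_lambdaInvariant_mul_natCard_eq` — **`p^{λ(X^∅)} · #B^Σ[p] = #Sel^Σ[p]`** where
  `B^Σ := Sel^Σ/Sel^∅` (g6's `p^{λ(X^∅)} = #Sel^∅[p]` and §1).
* §3 (two `p`-congruent curves) `pow_lambdaInvariant_mul_natCard_eq_of_torsionIso` — with the EXACT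
  residual comparison `#Sel^Σ(E₁)[p] = #Sel^Σ(E₂)[p]` (g6 `UniversalToricDescentResidualSelmerExact`, under
  (L), `p` odd, `Σ ⊇` bad places prime to `p`): `p^{λ₁^∅} · #B₁^Σ[p] = p^{λ₂^∅} · #B₂^Σ[p]`, (N1) assumed
  ONLY for `X^∅(E₁)`, `X^∅(E₂)`; torsion and `μ = 0` pass from `X^Σ(E₁)` to all four modules with NO
  (N1) (`isTorsion_and_muInvariant_eq_zero_all_of_torsionIso`); §4 the route's instance (`W, W′/ℚ`,
  `ModPCongruent`).

So the `Σ`-level obstruction of the algebraic half is ISOLATED as the finite group `B^Σ[p] =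
(Sel_𝔭^Σ/Sel_𝔭^∅)[p]` of each curve — the algebraic avatar of the `Σ`-Euler factors (GV00 Prop. 2.4 /
(2.10): when `loc_Σ` is onto, `B^Σ = ⊕_{w ∈ Σ} H¹(K_{∞,w}, E[p^∞])` and `#B^Σ[p] = p^{Σ_w s_w}`), which is
exactly what the analytic side must match curve by curve. HONEST STATUS: helper theorems; the
identification of `#B^Σ[p]` with local terms, the analytic congruence and 20395 remain. THEOREMS ONLY;
no definition, no named fact, no `sorry`. BSD is not advanced by this file.
References: [GreenbergVatsal2000] Thm. (1.4), §2 Prop. (2.4), (2.8), (2.10) (pp. 24–28);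
[Washington1997] §13.2; [GreenbergLNM1716] §1 p. 60, Prop. 4.14.
-/

set_option autoImplicit false
-- `…BirchSwinnertonDyer.BirchSwinnertonDyer.Theorems…` is the problem's mandated namespace (D-0017).
set_option linter.dupNamespace false

noncomputable section

open scoped Classical

namespace Summit.BirchSwinnertonDyer.BirchSwinnertonDyer.Theorems.UniversalToricDescentSigmaFree

open NumberField IsDedekindDomain Field WeierstrassCurve
open Literature.NumberTheory.EllipticCurves Literature.NumberTheory.EllipticCurves.IwasawaAlgebra
  Literature.NumberTheory.EllipticCurves.GreenbergSelmer
  Literature.NumberTheory.GaloisRepresentations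
  Summit.BirchSwinnertonDyer.Rank1Residual.X11b Summit.BirchSwinnertonDyer.Rank1Residual.X11b.AcSelmer
  Summit.BirchSwinnertonDyer.Rank1Residual.Iwasawa Summit.BirchSwinnertonDyer.Rank1Residual.Additive
  Summit.BirchSwinnertonDyer.BirchSwinnertonDyer.Theorems.UniversalToricDescentAcDualMuZero
  Summit.BirchSwinnertonDyer.BirchSwinnertonDyer.Theorems.UniversalToricDescentResidualSelmerTransfer
  Summit.BirchSwinnertonDyer.BirchSwinnertonDyer.Theorems.UniversalToricDescentResidualSelmerExact
  Summit.BirchSwinnertonDyer.BirchSwinnertonDyer.Theorems.UniversalToricDescentLambdaTransport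
  Summit.BirchSwinnertonDyer.BirchSwinnertonDyer.Theorems.UniversalToricDescentSigmaPassage

universe v

/-! ### §1 Pure group theory: `#A[n] = #H[n] · #(A/H)[n]` when `H` is `n`-divisible -/

section Group

variable {A : Type v} [AddCommGroup A]

/-- **`#A[n] = #H[n] · #(A/H)[n]` for an `n`-divisible subgroup `H`** (`Nat.card`, all three possibly
infinite): the restriction of `A → A/H` to `n`-torsion has kernel `H[n]` and is ONTO `(A/H)[n]` — a class
`ā` with `n ā = 0` has `n a ∈ H = nH`, say `n a = n h`, and `a − h ∈ A[n]` lifts `ā`; then Lagrange.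
[folklore] -/
theorem natCard_nsmulTorsion_eq_mul_of_divisible (H : AddSubgroup A) (n : ℕ)
    (hdiv : ∀ a ∈ H, ∃ b ∈ H, n • b = a) :
    Nat.card {a : A // n • a = 0} =
      Nat.card {h : H // n • h = 0} * Nat.card {b : A ⧸ H // n • b = 0} := by
  -- the `n`-torsion subgroups
  let TA : AddSubgroup A := AddSubgroup.torsionBy A n
  let TQ : AddSubgroup (A ⧸ H) := AddSubgroup.torsionBy (A ⧸ H) n
  have hTA : ∀ a : A, a ∈ TA ↔ n • a = 0 := fun a ↦ AddSubgroup.torsionBy.nsmul_iff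
  have hTQ : ∀ b : A ⧸ H, b ∈ TQ ↔ n • b = 0 := fun b ↦ AddSubgroup.torsionBy.nsmul_iff
  -- the projection restricted to `n`-torsion
  let φ₀ : TA →+ A ⧸ H := (QuotientAddGroup.mk' H).comp TA.subtype
  have hφ₀ : ∀ t : TA, φ₀ t ∈ TQ := by
    intro t
    rw [hTQ]
    show n • (QuotientAddGroup.mk' H (t : A)) = 0
    rw [← map_nsmul, (hTA (t : A)).mp t.2, map_zero]
  let φ : TA →+ TQ := φ₀.codRestrict TQ hφ₀
  -- `φ` is onto
  have hsurj : Function.Surjective φ := by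
    rintro ⟨q, hq⟩
    induction q using QuotientAddGroup.induction_on with
    | H a =>
      have hna : n • a ∈ H := by
        rw [← QuotientAddGroup.eq_zero_iff, QuotientAddGroup.mk_nsmul]
        exact (hTQ _).mp hq
      obtain ⟨h, hh, hnh⟩ := hdiv (n • a) hna
      have hah : a - h ∈ TA := by rw [hTA, nsmul_sub, hnh, sub_self]
      refine ⟨⟨a - h, hah⟩, Subtype.ext ?_⟩
      show QuotientAddGroup.mk' H (a - h) = (a : A ⧸ H)
      rw [map_sub, QuotientAddGroup.mk'_apply, QuotientAddGroup.mk'_apply,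
        (QuotientAddGroup.eq_zero_iff h).mpr hh, sub_zero]
  -- its kernel is `H[n]`
  have hker : ∀ t : TA, t ∈ φ.ker ↔ (t : A) ∈ H := by
    intro t
    rw [AddMonoidHom.mem_ker]
    constructor
    · intro h
      have h' : (φ t : A ⧸ H) = 0 := by rw [h]; rfl
      exact (QuotientAddGroup.eq_zero_iff (t : A)).mp h'
    · intro h
      apply Subtype.ext
      show QuotientAddGroup.mk' H (t : A) = 0
      exact (QuotientAddGroup.eq_zero_iff (t : A)).mpr h
  let e : φ.ker ≃ {h : H // n • h = 0} :=
    { toFun := fun t ↦ ⟨⟨((t : TA) : A), (hker t).mp t.2⟩,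
        Subtype.ext (by
          rw [AddSubgroupClass.coe_nsmul]
          exact (hTA _).mp (t : TA).2)⟩
      invFun := fun s ↦ ⟨⟨((s : H) : A), (hTA _).mpr (by
          rw [← AddSubgroupClass.coe_nsmul, s.2]; rfl)⟩, (hker _).mpr (s : H).2⟩
      left_inv := fun t ↦ by rfl
      right_inv := fun s ↦ by rfl }
  -- Lagrange
  have h1 : Nat.card TA = Nat.card (TA ⧸ φ.ker) * Nat.card φ.ker :=
    AddSubgroup.card_eq_card_quotient_mul_card_addSubgroup φ.ker
  have h2 : Nat.card (TA ⧸ φ.ker) = Nat.card TQ :=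
    Nat.card_congr (QuotientAddGroup.quotientKerEquivOfSurjective φ hsurj).toEquiv
  have h3 : Nat.card {a : A // n • a = 0} = Nat.card TA :=
    Nat.card_congr (Equiv.subtypeEquivRight fun a ↦ (hTA a).symm)
  have h4 : Nat.card {b : A ⧸ H // n • b = 0} = Nat.card TQ :=
    Nat.card_congr (Equiv.subtypeEquivRight fun b ↦ (hTQ b).symm)
  rw [h3, h4, h1, h2, Nat.card_congr e, mul_comm]

end Group

/-! ### §2 One curve: `p^{λ(X_ac^∅)} · #(Sel^Σ/Sel^∅)[p] = #Sel^Σ[p]` -/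

section OneCurve

variable {K : Type} [Field K] [NumberField K] (W : WeierstrassCurve K) [W.IsElliptic] (p : ℕ)
  [hp : Fact p.Prime] (κ : ZpExtension K p) (𝔭 : HeightOneSpectrum (𝓞 K))
  (S : Set (HeightOneSpectrum (𝓞 K))) (γ : absoluteGaloisGroup K) [Fact (κ.IsTopGenerator γ)]

/-- **`X_ac^Σ` torsion with `μ = 0` and no non-zero finite `Λ`-submodule ⟹ `X_ac^Σ` has no
`p`-torsion** (finite `Σ`): `μ = 0` makes `X` finitely generated over `ℤ_p` (Washington §13.2), and then
`X[p]` is a finite `Λ`-submodule (tree `Iwasawa.noZeroSMulDivisors_of_forall_finite_eq_bot`).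
[cite: Washington1997, §13.2 (after Thm. 13.12)] [cite: GreenbergVatsal2000, §2 Prop. (2.8) (proof, p. 27)] -/
theorem XAc.eq_zero_of_nsmul_eq_zero (hS : S.Finite)
    (hT : Module.IsTorsion (IwasawaAlgebra p) (XAc W p κ 𝔭 S γ))
    (hμ : muInvariant p (XAc W p κ 𝔭 S γ) = 0)
    (hnf : ∀ N : Submodule (IwasawaAlgebra p) (XAc W p κ 𝔭 S γ), Finite N → N = ⊥)
    (x : XAc W p κ 𝔭 S γ) (hx : p • x = 0) : x = 0 := by
  haveI := XAc.module_finite κ 𝔭 S γ hS (W := W)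
  letI : Module ℤ_[p] (XAc W p κ 𝔭 S γ) :=
    Module.compHom (XAc W p κ 𝔭 S γ) (algebraMap ℤ_[p] (IwasawaAlgebra p))
  haveI : IsScalarTower ℤ_[p] (IwasawaAlgebra p) (XAc W p κ 𝔭 S γ) :=
    IsScalarTower.of_compHom ℤ_[p] _ _
  haveI : Module.Finite ℤ_[p] (XAc W p κ 𝔭 S γ) := (muInvariant_eq_zero_iff_finite p _ hT).mp hμ
  haveI := noZeroSMulDivisors_of_forall_finite_eq_bot p (M := XAc W p κ 𝔭 S γ) hnf
  have hx' : ((p : ℕ) : ℤ_[p]) • x = 0 := by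
    rw [show ((p : ℕ) : ℤ_[p]) • x = (algebraMap ℤ_[p] (IwasawaAlgebra p) (p : ℕ)) • x from rfl,
      map_natCast, Nat.cast_smul_eq_nsmul]
    exact hx
  rcases smul_eq_zero.mp hx' with h | h
  · exact absurd h (Nat.cast_ne_zero.mpr hp.out.ne_zero)
  · exact h

omit [W.IsElliptic] in
/-- **`X_ac^Σ[p] = 0` ⟹ `Sel_𝔭^Σ(K_∞, E[p^∞])` is `p`-divisible.** If `s ∉ p·Sel`, a character `χ` of
`Sel/p·Sel` with `χ(s̄) ≠ 0` (characters into `ℚ/ℤ` separate points) pulls back to a non-zero `x ∈ X`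
with `p·x = 0`. [cite: GreenbergLNM1716, §1 p. 60 (Pontryagin duality for `Λ`-modules)] -/
theorem selmerAc_divisible_of_forall (h0 : ∀ x : XAc W p κ 𝔭 S γ, p • x = 0 → x = 0)
    (s : selmerAc W p κ 𝔭 S) : ∃ t : selmerAc W p κ 𝔭 S, p • t = s := by
  by_contra hs
  let H : AddSubgroup (selmerAc W p κ 𝔭 S) := (nsmulAddMonoidHom (α := selmerAc W p κ 𝔭 S) p).range
  have hsH : s ∉ H := by
    intro hmem
    obtain ⟨t, ht⟩ := AddMonoidHom.mem_range.mp hmem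
    exact hs ⟨t, by rw [← nsmulAddMonoidHom_apply]; exact ht⟩
  have hne : (QuotientAddGroup.mk' H s) ≠ 0 := by
    rw [QuotientAddGroup.mk'_apply, Ne, QuotientAddGroup.eq_zero_iff]
    exact hsH
  obtain ⟨χ, hχ⟩ := CharacterModule.exists_character_apply_ne_zero_of_ne_zero hne
  let x : XAc W p κ 𝔭 S γ :=
    (χ : (selmerAc W p κ 𝔭 S ⧸ H) →+ AddCircle (1 : ℚ)).comp (QuotientAddGroup.mk' H)
  have hpx : p • x = 0 := by
    apply DFunLike.ext
    intro t
    have hmem : p • t ∈ H := AddMonoidHom.mem_range.mpr ⟨t, nsmulAddMonoidHom_apply p t⟩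
    show (p • ((χ : (selmerAc W p κ 𝔭 S ⧸ H) →+ AddCircle (1 : ℚ)).comp (QuotientAddGroup.mk' H))) t
      = 0
    rw [AddMonoidHom.nsmul_apply, ← map_nsmul, AddMonoidHom.comp_apply,
      QuotientAddGroup.mk'_apply, (QuotientAddGroup.eq_zero_iff (p • t)).mpr hmem, map_zero]
  have hx0 : x = 0 := h0 x hpx
  apply hχ
  have := DFunLike.congr_fun hx0 s
  exact this

omit [W.IsElliptic] in
/-- **`Sel_𝔭^∅ ≤ Sel_𝔭^Σ` is `p`-divisible inside `Sel_𝔭^Σ` when `X_ac^∅[p] = 0`** (the subgroup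
`Sel^∅` of `Sel^Σ`, `selmerOver_mono`, viewed through `AddSubgroup.addSubgroupOf`).
[cite: Castella2018, Def. 2.2 (arXiv:1704.06608 p. 5), "`Σ`-imprimitive"] -/
theorem addSubgroupOf_empty_divisible (h0 : ∀ x : XAc W p κ 𝔭 ∅ γ, p • x = 0 → x = 0) :
    ∀ a ∈ (selmerAc W p κ 𝔭 ∅).addSubgroupOf (selmerAc W p κ 𝔭 S),
      ∃ b ∈ (selmerAc W p κ 𝔭 ∅).addSubgroupOf (selmerAc W p κ 𝔭 S), p • b = a := by
  intro a ha
  have ha' : (a : W.subgroupH1 p κ.kerSubgroup) ∈ selmerAc W p κ 𝔭 ∅ :=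
    AddSubgroup.mem_addSubgroupOf.mp ha
  obtain ⟨t, ht⟩ :=
    selmerAc_divisible_of_forall W p κ 𝔭 ∅ γ h0 (⟨(a : W.subgroupH1 p κ.kerSubgroup), ha'⟩ :
      selmerAc W p κ 𝔭 ∅)
  have ht' : p • (t : W.subgroupH1 p κ.kerSubgroup) = (a : W.subgroupH1 p κ.kerSubgroup) := by
    have := congrArg Subtype.val ht
    rw [AddSubgroupClass.coe_nsmul] at this
    exact this
  refine ⟨⟨(t : W.subgroupH1 p κ.kerSubgroup), selmerAc_empty_le t.2⟩,
    AddSubgroup.mem_addSubgroupOf.mpr t.2, ?_⟩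
  apply Subtype.ext
  rw [AddSubgroupClass.coe_nsmul]
  exact ht'

/-- **`p^{λ(X_ac^∅)} · #(Sel_𝔭^Σ/Sel_𝔭^∅)[p] = #Sel_𝔭^Σ[p]`** for ANY `Σ`, given `X_ac^∅` torsion with
`μ = 0` and no non-zero finite `Λ`-submodule (`Nat.card`; both sides `0` when `Sel^Σ[p]` is infinite):
`#Sel^Σ[p] = #Sel^∅[p] · #(Sel^Σ/Sel^∅)[p]` (§1, `Sel^∅` being `p`-divisible) and `#Sel^∅[p] = p^{λ(X^∅)}`
(g6 `pow_lambdaInvariant_eq_natCard_selmerAc_pTorsion`). This is the `Σ`-free form of Greenberg–Vatsal's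
"`λ_E = dim Sel^Σ[p] −` (local terms)". [cite: GreenbergVatsal2000, §2 Prop. (2.8) and (2.10) (pp. 26–28)] -/
theorem pow_lambdaInvariant_mul_natCard_eq
    (hT : Module.IsTorsion (IwasawaAlgebra p) (XAc W p κ 𝔭 ∅ γ))
    (hμ : muInvariant p (XAc W p κ 𝔭 ∅ γ) = 0)
    (hnf : ∀ N : Submodule (IwasawaAlgebra p) (XAc W p κ 𝔭 ∅ γ), Finite N → N = ⊥) :
    p ^ lambdaInvariant p (XAc W p κ 𝔭 ∅ γ) *
        Nat.card {b : selmerAc W p κ 𝔭 S ⧸ (selmerAc W p κ 𝔭 ∅).addSubgroupOf (selmerAc W p κ 𝔭 S) //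
          p • b = 0} =
      Nat.card {s : selmerAc W p κ 𝔭 S // p • s = 0} := by
  have h0 := XAc.eq_zero_of_nsmul_eq_zero W p κ 𝔭 ∅ γ Set.finite_empty hT hμ hnf
  rw [pow_lambdaInvariant_eq_natCard_selmerAc_pTorsion W p κ 𝔭 ∅ γ Set.finite_empty hT hμ hnf,
    natCard_nsmulTorsion_eq_mul_of_divisible
      ((selmerAc W p κ 𝔭 ∅).addSubgroupOf (selmerAc W p κ 𝔭 S)) p
      (addSubgroupOf_empty_divisible W p κ 𝔭 S γ h0)]
  congr 1
  -- `H[p] ≃ Sel^∅[p]` along `addSubgroupOfEquivOfLe`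
  refine Nat.card_congr ?_
  let e := AddSubgroup.addSubgroupOfEquivOfLe (selmerAc_empty_le (W := W) (p := p) (κ := κ) (𝔭 := 𝔭)
    (S := S))
  refine (Equiv.subtypeEquiv e.symm.toEquiv fun s ↦ ?_)
  show p • s = 0 ↔ p • e.symm s = 0
  rw [← map_nsmul, ← e.symm.map_zero]
  exact e.symm.injective.eq_iff.symm

end OneCurve

/-! ### §3 Two `p`-congruent curves over `K` -/

section TwoCurves

variable {K : Type} [Field K] [NumberField K] {p : ℕ} [hp : Fact p.Prime] (κ : ZpExtension K p)
  (γ : absoluteGaloisGroup K) [Fact (κ.IsTopGenerator γ)]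

/-- **Torsion and `μ = 0` for all four modules `X_ac^Σ(E_i)`, `X_ac^∅(E_i)` from the twin's `X_ac^Σ(E₁)`,
with NO (N1)**: `X_ac^Σ(E₁)` torsion, `μ = 0` ⟹ `Sel^Σ(E₁)[p]` finite (`finite_pTorsion_of_muInvariant_eq_zero`)
⟹ `Sel^Σ(E₂)[p]` finite (exact residual comparison, under (L)) and `Sel^∅(E_i)[p]` finite
(`finite_selmerAc_pTorsion_empty_of`) ⟹ criterion (A) for each.
[cite: GreenbergVatsal2000, §2 Prop. (2.8)] [cite: Washington1997, §13.2] -/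
theorem isTorsion_and_muInvariant_eq_zero_all_of_torsionIso (W₁ W₂ : WeierstrassCurve K) [W₁.IsElliptic]
    [W₂.IsElliptic] (hp2 : p ≠ 2) {𝔭 : HeightOneSpectrum (𝓞 K)} (h𝔭 : ((p : ℕ) : 𝓞 K) ∈ 𝔭.asIdeal)
    {S : Set (HeightOneSpectrum (𝓞 K))} (hS : S.Finite)
    (hS₁ : ∀ v : HeightOneSpectrum (𝓞 K), v ∉ S → ((p : ℕ) : 𝓞 K) ∉ v.asIdeal → W₁.HasGoodReductionAt v)
    (hS₂ : ∀ v : HeightOneSpectrum (𝓞 K), v ∉ S → ((p : ℕ) : 𝓞 K) ∉ v.asIdeal → W₂.HasGoodReductionAt v)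
    (e : W₁.geomTorsion (p : ℤ) ≃+ W₂.geomTorsion (p : ℤ))
    (he : ∀ (σ : absoluteGaloisGroup K) (P : W₁.geomTorsion (p : ℤ)), e (σ • P) = σ • e P)
    (hL : ∀ m : W₁.geomPrimaryTorsion p,
      (∀ σ ∈ κ.kerSubgroup ⊓ decomp 𝔭, σ • m = m) → p • m = 0 → m = 0)
    (hT₁ : Module.IsTorsion (IwasawaAlgebra p) (XAc W₁ p κ 𝔭 S γ))
    (hμ₁ : muInvariant p (XAc W₁ p κ 𝔭 S γ) = 0) :
    (Module.IsTorsion (IwasawaAlgebra p) (XAc W₂ p κ 𝔭 S γ) ∧ muInvariant p (XAc W₂ p κ 𝔭 S γ) = 0) ∧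
    (Module.IsTorsion (IwasawaAlgebra p) (XAc W₁ p κ 𝔭 ∅ γ) ∧ muInvariant p (XAc W₁ p κ 𝔭 ∅ γ) = 0) ∧
    (Module.IsTorsion (IwasawaAlgebra p) (XAc W₂ p κ 𝔭 ∅ γ) ∧ muInvariant p (XAc W₂ p κ 𝔭 ∅ γ) = 0) := by
  haveI := XAc.module_finite κ 𝔭 S γ hS (W := W₁)
  have hfin₁ : Set.Finite {s : selmerAc W₁ p κ 𝔭 S | p • s = 0} :=
    finite_pTorsion_of_muInvariant_eq_zero W₁ p κ 𝔭 S γ hT₁ hμ₁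
  have hcard := natCard_selmerAc_pTorsion_eq_of_torsionIso κ W₁ W₂ hp2 h𝔭 hS₁ hS₂ e he hL
  have hfin₂ : Set.Finite {s : selmerAc W₂ p κ 𝔭 S | p • s = 0} := by
    have hfin₁' : Finite {s : selmerAc W₁ p κ 𝔭 S // p • s = 0} := hfin₁.to_subtype
    have h0 : Nat.card {s : selmerAc W₁ p κ 𝔭 S // p • s = 0} ≠ 0 := by
      haveI : Nonempty {s : selmerAc W₁ p κ 𝔭 S // p • s = 0} := ⟨⟨0, smul_zero p⟩⟩
      exact Nat.card_pos.ne'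
    have : Finite {s : selmerAc W₂ p κ 𝔭 S // p • s = 0} := by
      apply Nat.finite_of_card_ne_zero; rw [← hcard]; exact h0
    exact Set.finite_coe_iff.mp this
  have hfin₁e := finite_selmerAc_pTorsion_empty_of W₁ κ hfin₁
  have hfin₂e := finite_selmerAc_pTorsion_empty_of W₂ κ hfin₂
  exact ⟨⟨isTorsion_of_finite_pTorsion W₂ p κ 𝔭 S γ hS hfin₂,
      muInvariant_eq_zero_of_finite_pTorsion W₂ p κ 𝔭 S γ hS hfin₂⟩,
    ⟨isTorsion_of_finite_pTorsion W₁ p κ 𝔭 ∅ γ Set.finite_empty hfin₁e,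
      muInvariant_eq_zero_of_finite_pTorsion W₁ p κ 𝔭 ∅ γ Set.finite_empty hfin₁e⟩,
    ⟨isTorsion_of_finite_pTorsion W₂ p κ 𝔭 ∅ γ Set.finite_empty hfin₂e,
      muInvariant_eq_zero_of_finite_pTorsion W₂ p κ 𝔭 ∅ γ Set.finite_empty hfin₂e⟩⟩

/-- **The `Σ`-free λ-transport.** For elliptic curves `E₁, E₂/K` with a `Γ_K`-equivariant `E₁[p] ≅ E₂[p]`,
`p` odd, `𝔭 ∋ p`, a finite `Σ ∌ 𝔭` containing the bad places of both curves prime to `p`, ANY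
`ℤ_p`-extension `K_∞` with (L) `E₁(K_{∞,𝔭})[p] = 0`, topological generator `γ`: if `X_ac^Σ(E₁)` is
`Λ`-torsion with `μ = 0` and the `Σ = ∅` duals `X_ac^∅(E₁)`, `X_ac^∅(E₂)` have no non-zero finite
`Λ`-submodule, then
`p^{λ(X_ac^∅(E₁))} · #(Sel^Σ(E₁)/Sel^∅(E₁))[p] = p^{λ(X_ac^∅(E₂))} · #(Sel^Σ(E₂)/Sel^∅(E₂))[p]`,
both sides equal to the common finite `#Sel^Σ(E_i)[p] ≠ 0`. (N1) at `Σ`-level is NOT needed.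
[cite: GreenbergVatsal2000, Thm. (1.4), §2 Prop. (2.8) and (2.10) (pp. 26–28)] -/
theorem pow_lambdaInvariant_mul_natCard_eq_of_torsionIso (W₁ W₂ : WeierstrassCurve K) [W₁.IsElliptic]
    [W₂.IsElliptic] (hp2 : p ≠ 2) {𝔭 : HeightOneSpectrum (𝓞 K)} (h𝔭 : ((p : ℕ) : 𝓞 K) ∈ 𝔭.asIdeal)
    {S : Set (HeightOneSpectrum (𝓞 K))}
    (hS₁ : ∀ v : HeightOneSpectrum (𝓞 K), v ∉ S → ((p : ℕ) : 𝓞 K) ∉ v.asIdeal → W₁.HasGoodReductionAt v)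
    (hS₂ : ∀ v : HeightOneSpectrum (𝓞 K), v ∉ S → ((p : ℕ) : 𝓞 K) ∉ v.asIdeal → W₂.HasGoodReductionAt v)
    (e : W₁.geomTorsion (p : ℤ) ≃+ W₂.geomTorsion (p : ℤ))
    (he : ∀ (σ : absoluteGaloisGroup K) (P : W₁.geomTorsion (p : ℤ)), e (σ • P) = σ • e P)
    (hL : ∀ m : W₁.geomPrimaryTorsion p,
      (∀ σ ∈ κ.kerSubgroup ⊓ decomp 𝔭, σ • m = m) → p • m = 0 → m = 0)
    (hT₁ : Module.IsTorsion (IwasawaAlgebra p) (XAc W₁ p κ 𝔭 ∅ γ))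
    (hμ₁ : muInvariant p (XAc W₁ p κ 𝔭 ∅ γ) = 0)
    (hnf₁ : ∀ N : Submodule (IwasawaAlgebra p) (XAc W₁ p κ 𝔭 ∅ γ), Finite N → N = ⊥)
    (hT₂ : Module.IsTorsion (IwasawaAlgebra p) (XAc W₂ p κ 𝔭 ∅ γ))
    (hμ₂ : muInvariant p (XAc W₂ p κ 𝔭 ∅ γ) = 0)
    (hnf₂ : ∀ N : Submodule (IwasawaAlgebra p) (XAc W₂ p κ 𝔭 ∅ γ), Finite N → N = ⊥) :
    p ^ lambdaInvariant p (XAc W₁ p κ 𝔭 ∅ γ) *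
        Nat.card {b : selmerAc W₁ p κ 𝔭 S ⧸ (selmerAc W₁ p κ 𝔭 ∅).addSubgroupOf (selmerAc W₁ p κ 𝔭 S) //
          p • b = 0} =
      p ^ lambdaInvariant p (XAc W₂ p κ 𝔭 ∅ γ) *
        Nat.card {b : selmerAc W₂ p κ 𝔭 S ⧸ (selmerAc W₂ p κ 𝔭 ∅).addSubgroupOf (selmerAc W₂ p κ 𝔭 S) //
          p • b = 0} := by
  rw [pow_lambdaInvariant_mul_natCard_eq W₁ p κ 𝔭 S γ hT₁ hμ₁ hnf₁,
    pow_lambdaInvariant_mul_natCard_eq W₂ p κ 𝔭 S γ hT₂ hμ₂ hnf₂]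
  exact natCard_selmerAc_pTorsion_eq_of_torsionIso κ W₁ W₂ hp2 h𝔭 hS₁ hS₂ e he hL

end TwoCurves

/-! ### §4 The route's instance: `W, W′/ℚ`, `ModPCongruent W′ W p`, base-changed to `K` -/

section Route

variable {p : ℕ} [hp : Fact p.Prime]

/-- **`Σ`-free λ-transport for the route's twin.** `W, W′/ℚ` with `W′[p] ≅ W[p]` (`ModPCongruent W′ W p`),
`K` a number field, ANY `ℤ_p`-extension `κ` with topological generator `γ`, `p` odd, `𝔭 ∋ p` the strict
place with (L) for `W′_K`, a finite `Σ ∌ 𝔭` containing the bad places of `W_K`, `W′_K` prime to `p`;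
the TWIN's `X_ac^Σ(W′_K)` torsion with `μ = 0`; (N1) for the two `Σ = ∅` modules ONLY. Then all four
modules are torsion with `μ = 0` and
`p^{λ(X_ac^∅(W_K))} · #(Sel^Σ/Sel^∅)(W_K)[p] = p^{λ(X_ac^∅(W′_K))} · #(Sel^Σ/Sel^∅)(W′_K)[p]`.
In crux #2 / 21845 (`p = 3`, strict place `𝔭′`, (L) from (iv) by `UniversalToricDescentStrictPlaceNoPTorsion`,
(N1) at `∅` from `UniversalToricDescentNoFiniteSubmoduleOfCoinvariants`) this is the algebraic λ-half
MODULO the two finite groups `(Sel^Σ/Sel^∅)[3]` — the `Σ`-Euler-factor terms.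
[cite: GreenbergVatsal2000, Thm. (1.4), §2 Prop. (2.8) and (2.10)] -/
theorem pow_lambdaInvariant_mul_natCard_baseChange_eq_of_modPCongruent (W W' : WeierstrassCurve ℚ)
    [W.IsElliptic] [W'.IsElliptic] (K : Type) [Field K] [NumberField K] (κ : ZpExtension K p)
    (γ : absoluteGaloisGroup K) [Fact (κ.IsTopGenerator γ)]
    (hp2 : p ≠ 2) {𝔭 : HeightOneSpectrum (𝓞 K)} (h𝔭 : ((p : ℕ) : 𝓞 K) ∈ 𝔭.asIdeal)
    {S : Set (HeightOneSpectrum (𝓞 K))} (hS : S.Finite)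
    (hSW : ∀ v : HeightOneSpectrum (𝓞 K), v ∉ S → ((p : ℕ) : 𝓞 K) ∉ v.asIdeal →
      (W.baseChange K).HasGoodReductionAt v)
    (hSW' : ∀ v : HeightOneSpectrum (𝓞 K), v ∉ S → ((p : ℕ) : 𝓞 K) ∉ v.asIdeal →
      (W'.baseChange K).HasGoodReductionAt v)
    (hcong : Summit.BirchSwinnertonDyer.Rank1Residual.O6.ModPCongruent W' W p)
    (hL : ∀ m : (W'.baseChange K).geomPrimaryTorsion p,
      (∀ σ ∈ κ.kerSubgroup ⊓ decomp 𝔭, σ • m = m) → p • m = 0 → m = 0)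
    (hT' : Module.IsTorsion (IwasawaAlgebra p) (XAc (W'.baseChange K) p κ 𝔭 S γ))
    (hμ' : muInvariant p (XAc (W'.baseChange K) p κ 𝔭 S γ) = 0)
    (hnf' : ∀ N : Submodule (IwasawaAlgebra p) (XAc (W'.baseChange K) p κ 𝔭 ∅ γ), Finite N → N = ⊥)
    (hnf : ∀ N : Submodule (IwasawaAlgebra p) (XAc (W.baseChange K) p κ 𝔭 ∅ γ), Finite N → N = ⊥) :
    (Module.IsTorsion (IwasawaAlgebra p) (XAc (W.baseChange K) p κ 𝔭 S γ) ∧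
        muInvariant p (XAc (W.baseChange K) p κ 𝔭 S γ) = 0) ∧
      (Module.IsTorsion (IwasawaAlgebra p) (XAc (W.baseChange K) p κ 𝔭 ∅ γ) ∧
        muInvariant p (XAc (W.baseChange K) p κ 𝔭 ∅ γ) = 0) ∧
      p ^ lambdaInvariant p (XAc (W.baseChange K) p κ 𝔭 ∅ γ) *
          Nat.card {b : selmerAc (W.baseChange K) p κ 𝔭 S ⧸
            (selmerAc (W.baseChange K) p κ 𝔭 ∅).addSubgroupOf (selmerAc (W.baseChange K) p κ 𝔭 S) //
            p • b = 0} =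
        p ^ lambdaInvariant p (XAc (W'.baseChange K) p κ 𝔭 ∅ γ) *
          Nat.card {b : selmerAc (W'.baseChange K) p κ 𝔭 S ⧸
            (selmerAc (W'.baseChange K) p κ 𝔭 ∅).addSubgroupOf (selmerAc (W'.baseChange K) p κ 𝔭 S) //
            p • b = 0} := by
  obtain ⟨e, he⟩ := exists_torsionIso_baseChange_of_modPCongruent (K := K) W W' hcong
  obtain ⟨⟨hT, hμ⟩, ⟨hT'e, hμ'e⟩, ⟨hTe, hμe⟩⟩ :=
    isTorsion_and_muInvariant_eq_zero_all_of_torsionIso κ γ (W'.baseChange K) (W.baseChange K) hp2 h𝔭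
      hS hSW' hSW e he hL hT' hμ'
  refine ⟨⟨hT, hμ⟩, ⟨hTe, hμe⟩, ?_⟩
  exact (pow_lambdaInvariant_mul_natCard_eq_of_torsionIso κ γ (W'.baseChange K) (W.baseChange K) hp2
    h𝔭 hSW' hSW e he hL hT'e hμ'e hnf' hTe hμe hnf).symm

end Route

end Summit.BirchSwinnertonDyer.BirchSwinnertonDyer.Theorems.UniversalToricDescentSigmaFree

end
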